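import Literature.IUT.HodgeTheaters.PMBaseIsoTorsorExactSideCondition

/-!
# [IUTchI] Prop 6.5 (i), second sentence, `XiGroupCompat` over a kit: the EXACT side condition (FACT-LIST F-2019)

S. Mochizuki, *Inter-universal Teichmüller theory I: construction of Hodge theaters*, §6, Example 6.3 (i)
pp. 160–161, Proposition 6.5 (i) pp. 163–164, Proposition 6.6 (ii) p. 165 of the kurims manuscript (May 2020)
[claim: Mochizuki2012, status: disputed].  PROOF-ONLY companion (theorems, no definitions) of abc-iut-L5-t4's
`PMBaseBridgeProps.lean` / `PMBaseDischarge.lean` (abc-iut cell, block F fact-proving wave, seat abc-iut-f-071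
gen 4; FACT-LIST row F-2019 `XiGroupCompat` — "`†ξ^{Θell}_{v_t,w_t} := (†ζ^{Θell}_{w_t})⁻¹ ∘ †ζ^{Θell}_{v_t}` is
compatible with the respective `𝔽_l^±`-group structures").

Record so far: abc-iut-L5-t4 proved the row from the synchronisation law (α) = `Ex63.PhiEllSync K`
(`DThetaEllBridge.xiGroupCompat_of_sync`); abc-iut-w4-d073 showed (α) independent of the interface and the
row's conclusion false over a two-place kit (`DThetaEllBridge.exists_kit_not_xiGroupCompat`).  Here:

* `DThetaEllBridge.forall_xiGroupCompat_iff_relSync` — **the exact side condition**: every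
  `𝒟-Θ^{ell}`-bridge over `K` satisfies `XiGroupCompat` iff the RELATIVE synchronisation law holds: for all
  places `v, w` and `±`-charts `e_v`, `e_w` of `LabCusp^±(𝒟_v)`, `LabCusp^±(𝒟_w)`, the two charts of
  `LabCusp^±(𝒟^{⊚±})` obtained by pulling back along the bijections induced by `φ^{Θell}_{•,v}`, `φ^{Θell}_{•,w}`
  differ by a SIGN (equivalently: the asynchrony of `φ^{Θell}_{•,v}` does not depend on `v`).  (α) says each of
  them is `±` the FIXED chart of Example 6.3 (i) — so (α) ⇒ relative synchronisation (`Ex63.relSync_of_phiEllSync`);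
* `Ex63.relSync_of_twistedNegCompat` — for `l` an odd prime the TWISTED `[−1]`-compatibility of
  `PMBaseIsoTorsorTwisted.lean` (one `d` for all `v`) implies relative synchronisation (the twist is twice the
  asynchrony); hence **Prop 6.6 (ii) for all pairs of `𝒟-Θ^{ell}`-bridges ⇒ Prop 6.5 (i), second sentence, for
  all bridges** over any kit (`DThetaEllBridge.xiGroupCompat_of_forall_isoTorsor`);
* `exists_kit_forall_xiGroupCompat_not_phiEllSync` — separation: over abc-iut-L5-t13's one-place translated toy
  kit (the kit of `exists_kit_forall_isoTorsor_not_negCompatModel`) every bridge satisfies `XiGroupCompat` while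
  (α) fails — (α) is sufficient, NOT necessary.

No side taken on [IUTchIII] Cor. 3.12; nothing asserted about the genuine objects of [IUTchI]; typed ≠ proved;
a FACT-LIST row is an assumption label, proved/refuted = OUR kernel check only.
-/

namespace Literature.IUT.HodgeTheaters

open CategoryTheory

universe u

namespace PMBaseKit

variable {l : ℕ} {K : PMBaseKit.{u} l}

namespace DThetaEllBridge

/-- **Relative synchronisation ⇒ Prop 6.5 (i), second sentence** ([IUTchI] Prop 6.5 (i) p. 164): if the
charts of `LabCusp^±(𝒟^{⊚±})` pulled back along `φ^{Θell}_{•,v}` and `φ^{Θell}_{•,w}` from `±`-charts differ by a sign,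
then every `†ξ^{Θell}_{v_t,w_t}` is compatible with the `𝔽_l^±`-group structures.  abc-iut-L5-t4's
`xiGroupCompat_of_sync` verbatim with the relative law in place of (α). [claim: Mochizuki2012, status: disputed] -/
theorem xiGroupCompat_of_relSync
    (hrel : ∀ (v w : K.V), ∀ ev ∈ (K.labPM v (K.model v) ⟨Iso.refl _⟩).charts,
      ∀ ew ∈ (K.labPM w (K.model w) ⟨Iso.refl _⟩).charts, ∃ η : ℤˣ,
        (Equiv.ofBijective _ (K.labOfHom_phiEll_bijective w)).symm.trans ew =
          ((Equiv.ofBijective _ (K.labOfHom_phiEll_bijective v)).symm.trans ev).trans (signPerm l η))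
    (B : K.DThetaEllBridge) : B.XiGroupCompat := by
  intro t v w ζv ζw hv hw
  obtain ⟨ι, hι, α, β, hpoly⟩ := B.exists_model
  obtain ⟨z, rfl⟩ := ι.surjective t
  obtain ⟨fv, hfv⟩ := B.poly_nonempty (ι z) v
  obtain ⟨fw, hfw⟩ := B.poly_nonempty (ι z) w
  have hζv : ζv = zetaCandidate v (α z v) β z :=
    Equiv.ext fun x => by rw [← hv.1 fv hfv, B.labOfHom_eq_zetaCandidate hpoly z v hfv]
  have hζw : ζw = zetaCandidate w (α z w) β z :=
    Equiv.ext fun x => by rw [← hw.1 fw hfw, B.labOfHom_eq_zetaCandidate hpoly z w hfw]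
  subst hζv hζw
  set Ev := Equiv.ofBijective _ (K.labOfHom_phiEll_bijective v) with hEv
  set Ew := Equiv.ofBijective _ (K.labOfHom_phiEll_bijective w) with hEw
  have hξ : (zetaCandidate v (α z v) β z).trans (zetaCandidate w (α z w) β z).symm =
      (K.labMap v (α z v).symm).trans (Ev.trans (Ew.symm.trans (K.labMap w (α z w).symm).symm)) := by
    ext x
    simp [zetaCandidate, hEv, hEw]
  rw [hξ]
  intro c hc
  set Sv := K.labPM v (K.model v) ⟨Iso.refl _⟩ with hSv
  set Sw := K.labPM w (K.model w) ⟨Iso.refl _⟩ with hSw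
  have h1 : (K.labMap w (α z w).symm).symm.trans c ∈ Sw.charts := by
    rw [← PMBaseKit.labMap_symm, Iso.symm_symm_eq]
    exact K.labMap_charts w ⟨Iso.refl _⟩ ((B.capsule (ι z)).isLocal w) (α z w) c hc
  obtain ⟨η, hη⟩ := hrel v w Sv.chart₀ Sv.chart₀_mem _ h1
  rw [← hEw, ← hEv] at hη
  have h2 : Ev.trans (Ew.symm.trans (((K.labMap w (α z w).symm).symm).trans c)) =
      Sv.chart₀.trans (signPerm l η) := by
    rw [hη]
    ext x
    simp
  have hfinal : ((K.labMap v (α z v).symm).trans (Ev.trans (Ew.symm.trans (K.labMap w (α z w).symm).symm))).trans c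
      = (K.labMap v (α z v).symm).trans (Sv.chart₀.trans (signPerm l η)) := by
    rw [Equiv.trans_assoc, Equiv.trans_assoc, Equiv.trans_assoc, h2]
  exact hfinal ▸ K.labMap_charts v ((B.capsule (ι z)).isLocal v) ⟨Iso.refl _⟩ (α z v).symm _
    (Sv.trans_signPerm_mem Sv.chart₀_mem _)

/-- **Prop 6.5 (i), second sentence, for the model bridge ⇒ relative synchronisation** ([IUTchI] Ex 6.3 (i)
p. 161, Prop 6.5 (i) p. 164): for the model `𝒟-Θ^{ell}`-bridge of Example 6.3 (i) at the label `0`, `ζ^{Θell}_{v_0}`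
is the bijection induced by `φ^{Θell}_{•,v}` itself, so `ξ^{Θell}_{v_0,w_0} = Ψ_w⁻¹ ∘ Ψ_v`; its compatibility with the
group structures says exactly that the pulled-back charts differ by a sign. [claim: Mochizuki2012, status: disputed] -/
theorem relSync_of_xiGroupCompat_model [NeZero l] (h : (Ex63.bridge K).XiGroupCompat) :
    ∀ (v w : K.V), ∀ ev ∈ (K.labPM v (K.model v) ⟨Iso.refl _⟩).charts,
      ∀ ew ∈ (K.labPM w (K.model w) ⟨Iso.refl _⟩).charts, ∃ η : ℤˣ,
        (Equiv.ofBijective _ (K.labOfHom_phiEll_bijective w)).symm.trans ew =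
          ((Equiv.ofBijective _ (K.labOfHom_phiEll_bijective v)).symm.trans ev).trans (signPerm l η) := by
  intro v w ev hev ew hew
  -- `ζ^{Θell}_{u_0}` of the model bridge is the bijection induced by `φ^{Θell}_{•,u}`
  have hζ : ∀ u : K.V, ∃ ζ : K.LabCuspPM u (K.model u) ≃ K.GLab K.gModel,
      (Ex63.bridge K).ZetaSpec (0 : ZMod l) u ζ ∧ ζ = Equiv.ofBijective _ (K.labOfHom_phiEll_bijective u) := by
    intro u
    obtain ⟨ζ, hζ⟩ : ∃ ζ : K.LabCuspPM u (K.model u) ≃ K.GLab K.gModel,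
        (Ex63.bridge K).ZetaSpec (0 : ZMod l) u ζ := (Ex63.bridge K).inducesZeta (0 : ZMod l) u
    refine ⟨ζ, hζ, Equiv.ext fun x => ?_⟩
    have h1 : (1 : Aut K.gModel) ∈ Ex63.lifts K (FlPM.transl 0) := by
      rw [Ex63.lifts_transl_zero]; exact one_mem _
    have hf : K.phiEll u ∈ (Ex63.bridge K).poly (0 : ZMod l) u :=
      ⟨1, one_mem _, 1, h1, by change K.phiEll u = 𝟙 _ ≫ K.phiEll u ≫ (K.atV u).map (𝟙 _); simp⟩
    have := congrFun (hζ.1 _ hf) x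
    exact this.symm
  obtain ⟨ζv, hζv, hv⟩ := hζ v
  obtain ⟨ζw, hζw, hw⟩ := hζ w
  have hcompat : ∀ c ∈ (K.labPM w (K.model w) ⟨Iso.refl _⟩).charts,
      (ζv.trans ζw.symm).trans c ∈ (K.labPM v (K.model v) ⟨Iso.refl _⟩).charts :=
    h (0 : ZMod l) v w ζv ζw hζv hζw
  obtain ⟨η, hη⟩ := (K.labPM v (K.model v) ⟨Iso.refl _⟩).exists_sign_of_mem hev (hcompat ew hew)
  refine ⟨η, ?_⟩
  rw [← hv, ← hw]
  calc ζw.symm.trans ew = ζv.symm.trans ((ζv.trans ζw.symm).trans ew) := by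
        ext x; simp
    _ = (ζv.symm.trans ev).trans (signPerm l η) := by rw [hη, Equiv.trans_assoc]

/-- **[IUTchI] Prop 6.5 (i), second sentence, over a kit — the EXACT side condition** (p. 164; FACT-LIST
F-2019): every `𝒟-Θ^{ell}`-bridge over `K` satisfies `XiGroupCompat` iff the relative synchronisation law holds
(charts of `LabCusp^±(𝒟^{⊚±})` pulled back along `φ^{Θell}_{•,v}` and `φ^{Θell}_{•,w}` from `±`-charts differ by a
sign).  (α) = `Ex63.PhiEllSync` (each pulled-back chart is `±` the fixed chart) is the sufficient, not
necessary, special case. [claim: Mochizuki2012, status: disputed] -/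
theorem forall_xiGroupCompat_iff_relSync [NeZero l] :
    (∀ B : K.DThetaEllBridge, B.XiGroupCompat) ↔
      ∀ (v w : K.V), ∀ ev ∈ (K.labPM v (K.model v) ⟨Iso.refl _⟩).charts,
        ∀ ew ∈ (K.labPM w (K.model w) ⟨Iso.refl _⟩).charts, ∃ η : ℤˣ,
          (Equiv.ofBijective _ (K.labOfHom_phiEll_bijective w)).symm.trans ew =
            ((Equiv.ofBijective _ (K.labOfHom_phiEll_bijective v)).symm.trans ev).trans (signPerm l η) :=
  ⟨fun h => relSync_of_xiGroupCompat_model (h _), fun h B => xiGroupCompat_of_relSync h B⟩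

/-- **Prop 6.5 (i), second sentence, for the model bridge already gives it for every bridge**
([IUTchI] Prop 6.5 (i) p. 164). [claim: Mochizuki2012, status: disputed] -/
theorem xiGroupCompat_of_xiGroupCompat_model [NeZero l] (h : (Ex63.bridge K).XiGroupCompat)
    (B : K.DThetaEllBridge) : B.XiGroupCompat :=
  xiGroupCompat_of_relSync (relSync_of_xiGroupCompat_model h) B

end DThetaEllBridge

namespace Ex63

/-- **(α) ⇒ relative synchronisation** ([IUTchI] Ex 6.3 (i) pp. 160–161): if every pulled-back chart is `±` the
fixed chart, any two of them differ by a sign. [claim: Mochizuki2012, status: disputed] -/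
theorem relSync_of_phiEllSync (hsync : PhiEllSync K) :
    ∀ (v w : K.V), ∀ ev ∈ (K.labPM v (K.model v) ⟨Iso.refl _⟩).charts,
      ∀ ew ∈ (K.labPM w (K.model w) ⟨Iso.refl _⟩).charts, ∃ η : ℤˣ,
        (Equiv.ofBijective _ (K.labOfHom_phiEll_bijective w)).symm.trans ew =
          ((Equiv.ofBijective _ (K.labOfHom_phiEll_bijective v)).symm.trans ev).trans (signPerm l η) := by
  intro v w ev hev ew hew
  obtain ⟨εv, hεv⟩ := hsync v ev hev
  obtain ⟨εw, hεw⟩ := hsync w ew hew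
  refine ⟨εw * εv⁻¹, ?_⟩
  rw [hεv, hεw]
  ext y
  simp only [Equiv.trans_apply, signPerm_apply, smul_smul, inv_mul_cancel_right]

/-- **Twisted `[−1]`-compatibility ⇒ relative synchronisation** ([IUTchI] Ex 6.3 (i), (ii) pp. 160–161), `l` a
prime (odd, as a place exists): if ONE `d ∈ 𝔽_l` works at every `v` — a negative automorphism `a_v` of `𝒟_v` and a
lift `b ∈ Aut_±(𝒟^{⊚±})` of `(d, −1)` with `a_v ≫ φ^{Θell}_{•,v} = φ^{Θell}_{•,v} ≫ b` — then, reading the square on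
`±`-label classes in a `±`-chart `e_v = (x ↦ ε_v G(x) + c_v)` (`G` the fixed-chart value along `φ^{Θell}_{•,v}`),
`ε_v d = −2 c_v`; so `ε_v c_v = ε_w c_w` for all `v, w` (`2` is invertible), i.e. the pulled-back charts at `v`
and `w` differ by the sign `ε_w ε_v`. [claim: Mochizuki2012, status: disputed] -/
theorem relSync_of_twistedNegCompat [Fact l.Prime] {d : ZMod l}
    (htw : ∀ v, ∃ a : K.model v ≅ K.model v, K.labMap v a = labNeg (K.isLocal_model v) ∧
      ∃ b ∈ lifts K (FlPM.mk d (-1)), a.hom ≫ K.phiEll v = K.phiEll v ≫ (K.atV v).map b.hom) :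
    ∀ (v w : K.V), ∀ ev ∈ (K.labPM v (K.model v) ⟨Iso.refl _⟩).charts,
      ∀ ew ∈ (K.labPM w (K.model w) ⟨Iso.refl _⟩).charts, ∃ η : ℤˣ,
        (Equiv.ofBijective _ (K.labOfHom_phiEll_bijective w)).symm.trans ew =
          ((Equiv.ofBijective _ (K.labOfHom_phiEll_bijective v)).symm.trans ev).trans (signPerm l η) := by
  -- at each place: the pulled-back chart is `γ`-affine relative to the fixed chart, with `ε • d = −(c + c)`
  have key : ∀ (u : K.V), ∀ eu ∈ (K.labPM u (K.model u) ⟨Iso.refl _⟩).charts, ∃ γ : FlPM l,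
      (Equiv.ofBijective _ (K.labOfHom_phiEll_bijective u)).symm.trans eu = K.gChart₀.trans (FlPM.toPerm l γ) ∧
        γ.right • d = -(γ.left.toAdd + γ.left.toAdd) := by
    intro u eu heu
    obtain ⟨a, ha, b, hb, hab⟩ := htw u
    obtain ⟨γ, hγ⟩ := K.gLabT.exists_of_mem K.gChart₀_mem (K.labOfHom_phiEll_charts u eu heu)
    refine ⟨γ, hγ, ?_⟩
    set S := K.labPM u (K.model u) (K.isLocal_model u) with hS
    have hE : ∀ x, eu x = γ • K.gChart₀ (K.labOfHom u (K.phiEll u) x) := fun x => by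
      have := congrArg (fun f => f (Equiv.ofBijective _ (K.labOfHom_phiEll_bijective u) x)) hγ
      simpa using this
    obtain ⟨η, hη⟩ := S.exists_sign_of_mem S.chart₀_mem heu
    have hN : ∀ x, eu (labNeg (K.isLocal_model u) x) = -eu x := fun x => by
      rw [hη]
      simp [labNeg, hS, Units.neg_smul, smul_neg]
    have hsq := labOfHom_phiEll_comp_labMap hab
    rw [ha] at hsq
    have hG : ∀ x, K.gChart₀ (K.labOfHom u (K.phiEll u) (labNeg (K.isLocal_model u) x)) =
        -K.gChart₀ (K.labOfHom u (K.phiEll u) x) + d := fun x => by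
      have := congrFun hsq x
      simp only [Function.comp_apply] at this
      rw [this, ((mem_lifts_iff_gChart₀ _ _).mp hb).2, FlPM.mk_smul, Units.neg_smul, one_smul]
    have h1 := hN (S.chart₀.symm 0)
    rw [hE, hE, hG, FlPM.smul_def, FlPM.smul_def, smul_add, smul_neg] at h1
    linear_combination h1
  intro v w ev hev ew hew
  obtain ⟨γv, hγv, hv⟩ := key v ev hev
  obtain ⟨γw, hγw, hw⟩ := key w ew hew
  -- the signs as ring elements
  have hsign : ∀ ε : ℤˣ, ∃ a : ZMod l, a * a = 1 ∧ ∀ x : ZMod l, ε • x = a * x := fun ε =>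
    ⟨((ε : ℤ) : ZMod l), by rcases Int.units_eq_one_or ε with h | h <;> simp [h],
      fun x => by rw [Units.smul_def, zsmul_eq_mul]⟩
  obtain ⟨av, hav, hεv⟩ := hsign γv.right
  obtain ⟨aw, haw, hεw⟩ := hsign γw.right
  set cv := γv.left.toAdd with hcv
  set cw := γw.left.toAdd with hcw
  rw [hεv] at hv
  rw [hεw] at hw
  have h2 : (2 : ZMod l) ≠ 0 := two_ne_zero_of_isLocal (K.isLocal_model v)
  have hrel : cw = aw * av * cv := by
    have h3 : (2 : ZMod l) * (cw - aw * av * cv) = 0 := by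
      linear_combination hw - aw * av * hv + aw * d * hav
    exact sub_eq_zero.mp ((mul_eq_zero.mp h3).resolve_left h2)
  refine ⟨γw.right * γv.right, ?_⟩
  rw [hγw, hγv]
  ext y
  simp only [Equiv.trans_apply, FlPM.toPerm_apply, signPerm_apply, FlPM.smul_def, mul_smul, hεv, hεw]
  rw [← hcv, ← hcw, mul_add]
  linear_combination (-(aw * K.gChart₀ y)) * hav + hrel

end Ex63

namespace DThetaEllBridge

/-- **Prop 6.6 (ii) ⇒ Prop 6.5 (i), second sentence, over any kit** ([IUTchI] pp. 164–165), `l` a prime: if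
`DThetaEllBridge.IsoTorsor` holds for all pairs of `𝒟-Θ^{ell}`-bridges over `K`, then every bridge over `K`
satisfies `XiGroupCompat` — through the twisted `[−1]`-compatibility (`forall_isoTorsor_iff_twistedNegCompat`)
and relative synchronisation. [claim: Mochizuki2012, status: disputed] -/
theorem xiGroupCompat_of_forall_isoTorsor [Fact l.Prime] (h : ∀ B₁ B₂ : K.DThetaEllBridge, IsoTorsor B₁ B₂)
    (B : K.DThetaEllBridge) : B.XiGroupCompat := by
  haveI : NeZero l := ⟨(Fact.out : l.Prime).ne_zero⟩
  by_cases hV : Nonempty K.V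
  · obtain ⟨d, hd⟩ := forall_isoTorsor_iff_twistedNegCompat.mp h hV
    exact xiGroupCompat_of_relSync (Ex63.relSync_of_twistedNegCompat hd) B
  · exact xiGroupCompat_of_relSync (fun v => absurd ⟨v⟩ hV) B

/-- **(β) ⇒ Prop 6.5 (i), second sentence** recovered (abc-iut-L5-t13's
`xiGroupCompat_of_negCompatModel` through Prop 6.6 (ii) instead of (α)). [claim: Mochizuki2012, status: disputed] -/
theorem xiGroupCompat_of_negCompatModel' [Fact l.Prime] (h : Ex63.NegCompatModel K) (B : K.DThetaEllBridge) :
    B.XiGroupCompat :=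
  xiGroupCompat_of_forall_isoTorsor (isoTorsor_of_negCompatModel h) B

end DThetaEllBridge

/-- **(α) is sufficient, NOT necessary, for Prop 6.5 (i), second sentence** (explicit kit, universe `0`):
over abc-iut-L5-t13's one-place translated toy kit (the separating kit of
`exists_kit_forall_isoTorsor_not_negCompatModel`) every `𝒟-Θ^{ell}`-bridge satisfies `XiGroupCompat` — via
Prop 6.6 (ii), which holds there for all pairs — while the synchronisation law (α) = `Ex63.PhiEllSync` (and (β))
FAIL. [claim: Mochizuki2012, status: disputed] -/
theorem exists_kit_forall_xiGroupCompat_not_phiEllSync (l : ℕ) [Fact l.Prime] (hl : l ≠ 2) :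
    ∃ K : PMBaseKit.{0} l, Nonempty K.V ∧ (∀ B : K.DThetaEllBridge, B.XiGroupCompat) ∧
      ¬ Ex63.PhiEllSync K ∧ ¬ Ex63.NegCompatModel K := by
  obtain ⟨K, hV, hiso, -, hns, hN, -⟩ := exists_kit_forall_isoTorsor_not_negCompatModel l hl
  exact ⟨K, hV, fun B => DThetaEllBridge.xiGroupCompat_of_forall_isoTorsor hiso B, hns, hN⟩

/-- **F-2019 — exact-side-condition verdict, assembled** ([IUTchI] Prop 6.5 (i) p. 164): over every kit
(`l ≠ 0`) `XiGroupCompat` for all bridges ⟺ relative synchronisation; (α) ⇒ it; Prop 6.6 (ii) for all pairs ⇒ it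
(`l` prime); and for every odd prime `l` some kit has it WITHOUT (α). [claim: Mochizuki2012, status: disputed] -/
theorem DThetaEllBridge.xiGroupCompat_exact_side_condition_verdict :
    (∀ (l : ℕ) [NeZero l] (K : PMBaseKit.{u} l),
      (∀ B : K.DThetaEllBridge, B.XiGroupCompat) ↔
        ∀ (v w : K.V), ∀ ev ∈ (K.labPM v (K.model v) ⟨Iso.refl _⟩).charts,
          ∀ ew ∈ (K.labPM w (K.model w) ⟨Iso.refl _⟩).charts, ∃ η : ℤˣ,
            (Equiv.ofBijective _ (K.labOfHom_phiEll_bijective w)).symm.trans ew =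
              ((Equiv.ofBijective _ (K.labOfHom_phiEll_bijective v)).symm.trans ev).trans (signPerm l η)) ∧
    (∀ (l : ℕ) (K : PMBaseKit.{u} l), Ex63.PhiEllSync K → ∀ B : K.DThetaEllBridge, B.XiGroupCompat) ∧
    (∀ (l : ℕ) [Fact l.Prime] (K : PMBaseKit.{u} l),
      (∀ B₁ B₂ : K.DThetaEllBridge, DThetaEllBridge.IsoTorsor B₁ B₂) → ∀ B : K.DThetaEllBridge, B.XiGroupCompat) ∧
    (∀ (l : ℕ) [Fact l.Prime], l ≠ 2 → ∃ K : PMBaseKit.{0} l, Nonempty K.V ∧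
      (∀ B : K.DThetaEllBridge, B.XiGroupCompat) ∧ ¬ Ex63.PhiEllSync K) :=
  ⟨fun _ _ _ => DThetaEllBridge.forall_xiGroupCompat_iff_relSync,
    fun _ _ h => DThetaEllBridge.xiGroupCompat_of_sync h,
    fun _ _ _ h => DThetaEllBridge.xiGroupCompat_of_forall_isoTorsor h,
    fun l _ hl => by
      obtain ⟨K, hV, hxi, hns, -⟩ := exists_kit_forall_xiGroupCompat_not_phiEllSync l hl
      exact ⟨K, hV, hxi, hns⟩⟩

end PMBaseKit

end Literature.IUT.HodgeTheaters
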